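import Summits.BirchSwinnertonDyer.BirchSwinnertonDyer.Theorems.EisensteinPrimesX2AlgebraicLambdaGESplitTorsion
import Summits.BirchSwinnertonDyer.BirchSwinnertonDyer.Theorems.EisensteinPrimesAnalyticLambdaParityLemma
import HarnessLib

/-!
# Route `EisensteinPrimes`, line `mudescent`, stub `stub_lambdaCount_offLocus` (crux 3): the ORDER CLAUSE
# «X ≥ 1» of THEOREM C^mix is a THEOREM at a split Eisenstein prime, layer 0 (helper; closes nothing)

Seat `bsd-eis-lam-a` g13 (ANALYTIC half of stub 4), item stmt-BirchSwinnertonDyer-19033 (crux 3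
`MazurMCOnCellB`). MEMO-11 §3b / MEMO-12 §1, §8: THEOREM C^mix's Sig carries, per non-split partner
class, an ORDER CLAUSE standing in for the READ inequality `e^{ns}_q ≥ 1`
(`X := λ_an − Σ_{split ℓ ≠ p} s_ℓ ≥ 1`, read 352/352 + every basis class, never proved); MEMO-12 §8
noted that at a SPLIT-`p` realiser whose `s`-factors are all `1` it would follow from Kato–Wuthrich,
lam-b's layer-`0` Tamagawa budget WITH torsion, and the parity lemma. All three are now in the tree,
so this file proves it:

* `X2.card_le_analyticLambda_of_dvd_localTamagawaNumber` — `W / ℚ` globally minimal, `p ≠ 2`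
  multiplicative with `p ∣ #E(ℚ)_tors` and `v_p(#E(ℚ)_tors) = 1` (the étale end), `S` a set of places
  `v ∤ p` with `p ∣ c_v(E)`, a certified pair `μ_an = 0` (`X2.AnalyticMuLE W p 0`), `λ_an = n`: then
  **`#S ≤ n`** — lam-b's budget `λ(X) ≥ #S + 1 − 2` (`X2.algebraicLambdaGE_of_dvd_torsionOrder_of_dvd_localTamagawaNumber`,
  p480562: Greenberg's Cor. 5.6 count with the a-term `a = 1` of the split prime and `δ = 1`) and the
  Kato–Wuthrich direction `λ(X) + 1 ≤ λ_an` (`X2.add_le_of_algebraicLambdaGE_of_analyticLambdaEq`);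
* `X2.card_splitPrimesOutside_lt_analyticLambda` — if moreover the conductor is squarefree and every
  split prime `ℓ ≠ p` is one of the Tamagawa places (`#splitPrimesOutside W p p ≤ #S`; e.g. the Kummer
  support of `W` contains no split prime — the NON-SPLIT-type classes of MEMO-11/12), then
  **`#splitPrimesOutside W p p < n`**: the PARITY LEMMA (`X2.odd_analyticLambda_add_card_splitPrimesOutside`,
  p610314) forbids equality;
* `X2.sum_sFactor_lt_analyticLambda_of_forall_sFactor_eq_one` — **the ORDER CLAUSE**: if in addition
  every `ℓ ∈ splitPrimesOutside W p p` has `s_ℓ = 1`, then `Σ_{ℓ ∈ splitPrimesOutside W p p} s_ℓ < n`,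
  i.e. `X = λ_an − Σ s_ℓ ≥ 1` — BY THEOREM at every split-`p` étale end with unit `s`-factors whose
  split primes all carry `p ∣ c_ℓ`. (With some `s_ℓ > 1` the layer-0 a-term no longer suffices and
  the tower budget of the LEAD's p608923 has no a-term: there one gets only `X ≥ −1`; not claimed.)

Named PUBLISHED facts, as hypotheses, exactly those of the three inputs: Poitou–Tate over `ℚ` (`hPT`),
Greenberg 1999 Prop. 4.15 (ii) (`h415`), Wuthrich 2014 Thm. 16 (`hWu`), modularity (`hpar`).
HONEST FRAMING (cell `bsd-eis`): THEOREMS ONLY, no definition, no new named fact; closes no stub; 0 cells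
/ labels move; nothing is proved about any particular curve; BSD / Mazur's MC proved for no curve.
References: [GreenbergLNM1716] §5 pp. 114–118, p. 137 (Cor. 5.6), Prop. 4.15 (ii); [Wuthrich2014]
Thm. 16; [MazurTateTeitelbaum1986Invent] §I.17–I.18; HOME/lam-a-g12/lam-a-MEMO-12.md §1, §8.
-/

-- `Summit.BirchSwinnertonDyer.BirchSwinnertonDyer.…`: the summit and its single sub-problem share a
-- name (D-0017 layout), as in every `EisensteinPrimes*` Theorems file.
set_option linter.dupNamespace false
set_option autoImplicit false

noncomputable section

open scoped Classical

open Function Field NumberField IsDedekindDomain WeierstrassCurve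
  Literature.NumberTheory.EllipticCurves Literature.NumberTheory.GaloisRepresentations
  Literature.NumberTheory.GaloisCohomology
  Literature.NumberTheory.EllipticCurves.Rank1Residual Literature.NumberTheory.EllipticCurves.ModularForms
  Literature.NumberTheory.EllipticCurves.GreenbergVatsal2000
  Summit.BirchSwinnertonDyer.Rank1Residual
  Summit.BirchSwinnertonDyer.Rank1Residual.X1.TamagawaSqueeze
  Summit.BirchSwinnertonDyer.BirchSwinnertonDyer.Theorems.EisensteinPrimesMazurTwinFamily
  Summit.BirchSwinnertonDyer.BirchSwinnertonDyer.Theorems.EisensteinPrimesX2AlgebraicLambdaGESplitTorsion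
  Summit.BirchSwinnertonDyer.BirchSwinnertonDyer.Theorems.EisensteinPrimesAnalyticLambdaParityLemma

namespace Summit.BirchSwinnertonDyer.BirchSwinnertonDyer.Theorems.EisensteinPrimesX2OrderClauseLayerZero

variable (W : WeierstrassCurve ℚ) [W.IsElliptic] [W.IsGloballyMinimal] (p : ℕ) [hp : Fact p.Prime]

/-- **`#S ≤ λ_an` at the étale end of a split Eisenstein prime** (`S` = places `v ∤ p` with `p ∣ c_v`).
`W / ℚ` globally minimal, `p ≠ 2` multiplicative, `p ∣ #E(ℚ)_tors` with `v_p(#E(ℚ)_tors) = 1`,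
`μ_an = 0` and `λ_an = n` certified (`X2.AnalyticMuLE W p 0`, `X2.AnalyticLambdaEq W p n`). Then
`#S ≤ n`: the layer-0 Tamagawa budget with torsion gives `λ(X(E/ℚ_∞)) ≥ #S − 1`
(`X2.algebraicLambdaGE_of_dvd_torsionOrder_of_dvd_localTamagawaNumber`, `b = #S − 1`,
`b + 2·1 ≤ #S + 1`), and Kato–Wuthrich at the (forced) SPLIT prime gives `λ(X) + 1 ≤ λ_an`
(`X2.add_le_of_algebraicLambdaGE_of_analyticLambdaEq`). Named facts `hPT h415 hWu hpar`.
[cite: GreenbergLNM1716, §5 pp. 114–118, p. 137, Prop. 4.15 (ii)] [cite: Wuthrich2014, Thm. 16 (p. 397)] -/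
theorem X2.card_le_analyticLambda_of_dvd_localTamagawaNumber (hodd : p ≠ 2)
    (hPT : poitouTate_selmerStructure_duality ℚ)
    (h415 : Greenberg1999.prop415ii_noFiniteSubmodule_of_ordinary_or_multiplicative)
    (hWu : Wuthrich2014.thm16_charIdeal_dvd_multiplicative_of_reducible)
    (hpar : nonempty_modularParametrizationData)
    (hmult : W.HasMultiplicativeReductionAtPrime p) (htors : p ∣ W.torsionOrder)
    (hfac : (W.torsionOrder).factorization p = 1)
    (S : Finset (HeightOneSpectrum (𝓞 ℚ))) (hSp : ∀ v ∈ S, ((p : ℕ) : 𝓞 ℚ) ∉ v.asIdeal)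
    (hcv : ∀ v ∈ S,
      p ∣ (W.baseChange (v.adicCompletion ℚ)).localTamagawaNumber (v.adicCompletionIntegers ℚ))
    {n : ℕ} (hμ0 : X2.AnalyticMuLE W p 0) (hlam : X2.AnalyticLambdaEq W p n) : S.card ≤ n := by
  have hpP : p.Prime := hp.out
  have hp3 : 3 ≤ p := by have h2 := hpP.two_le; omega
  have hred : ¬ W.HasIrreducibleModPGaloisRep p :=
    not_hasIrreducibleModPGaloisRep_of_dvd_torsionOrder W p htors
  have hsplit : W.HasSplitMultiplicativeReductionAtPrime p :=
    X2.hasSplitMultiplicativeReductionAtPrime_of_dvd_torsionOrder W p hp3 hmult htors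
  rcases Nat.eq_zero_or_pos S.card with h0 | hpos
  · rw [h0]; exact Nat.zero_le _
  · -- budget `λ_alg ≥ #S − 1` (layer 0, a = 1, δ = 1, m = 0)
    have hb : (S.card - 1) + 2 * (W.torsionOrder).factorization p ≤ S.card + 1 := by
      rw [hfac]; omega
    have halg : AlgebraicLambdaGE W p (S.card - 1 - 0) :=
      X2.algebraicLambdaGE_of_dvd_torsionOrder_of_dvd_localTamagawaNumber hodd hPT h415 hWu hpar hmult
        htors S hSp hcv hμ0 hb
    rw [Nat.sub_zero] at halg
    -- Kato–Wuthrich at the split prime: `(#S − 1) + 1 ≤ n`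
    have hle := (X2.add_le_of_algebraicLambdaGE_of_analyticLambdaEq hWu hpar W p hodd hmult hred hμ0
      hlam halg).2 hsplit
    omega

/-- **`#{split ℓ ∣ N, ℓ ≠ p} < λ_an`** at a split Eisenstein étale end of a SEMISTABLE curve all of
whose split primes `ℓ ≠ p` are Tamagawa places (`#splitPrimesOutside W p p ≤ #S`; e.g. when the Kummer
support of `W` contains no split prime): `#S ≤ λ_an` (previous theorem) and `λ_an + #splitPrimesOutside W p p`
is odd (PARITY LEMMA, `X2.odd_analyticLambda_add_card_splitPrimesOutside`), so equality is impossible.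
[cite: GreenbergLNM1716, §5 pp. 114–118, p. 137] [cite: MazurTateTeitelbaum1986Invent, §I.17–I.18] -/
theorem X2.card_splitPrimesOutside_lt_analyticLambda (hodd : p ≠ 2)
    (hPT : poitouTate_selmerStructure_duality ℚ)
    (h415 : Greenberg1999.prop415ii_noFiniteSubmodule_of_ordinary_or_multiplicative)
    (hWu : Wuthrich2014.thm16_charIdeal_dvd_multiplicative_of_reducible)
    (hpar : nonempty_modularParametrizationData) (hsq : Squarefree (W.conductorNorm ℤ))
    (hmult : W.HasMultiplicativeReductionAtPrime p) (htors : p ∣ W.torsionOrder)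
    (hfac : (W.torsionOrder).factorization p = 1)
    (S : Finset (HeightOneSpectrum (𝓞 ℚ))) (hSp : ∀ v ∈ S, ((p : ℕ) : 𝓞 ℚ) ∉ v.asIdeal)
    (hcv : ∀ v ∈ S,
      p ∣ (W.baseChange (v.adicCompletion ℚ)).localTamagawaNumber (v.adicCompletionIntegers ℚ))
    (hS : (splitPrimesOutside W p p).card ≤ S.card)
    {n : ℕ} (hμ0 : X2.AnalyticMuLE W p 0) (hlam : X2.AnalyticLambdaEq W p n) :
    (splitPrimesOutside W p p).card < n := by
  have hle := X2.card_le_analyticLambda_of_dvd_localTamagawaNumber W p hodd hPT h415 hWu hpar hmult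
    htors hfac S hSp hcv hμ0 hlam
  have hodd' := X2.odd_analyticLambda_add_card_splitPrimesOutside W p hWu hpar hsq hodd hmult
    (not_hasIrreducibleModPGaloisRep_of_dvd_torsionOrder W p htors) hμ0 hlam
  rcases (hS.trans hle).lt_or_eq with hlt | heq
  · exact hlt
  · exfalso
    rw [heq, ← two_mul] at hodd'
    exact Nat.not_odd_iff_even.mpr (even_two_mul n) hodd'

/-- **THE ORDER CLAUSE «`X ≥ 1`» IS A THEOREM at a split Eisenstein prime with unit `s`-factors.**
Under the hypotheses of `X2.card_splitPrimesOutside_lt_analyticLambda`, if every split prime `ℓ ≠ p`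
has `s_ℓ = 1` (at `p = 3`: `ℓ ≢ ±1 (mod 9)`), then `Σ_{ℓ ∈ splitPrimesOutside W p p} s_ℓ < λ_an`, i.e.
`X := λ_an − Σ_{split ℓ ≠ p} s_ℓ ≥ 1` — the content of the per-partner order clause of THEOREM C^mix's Sig
(lam-a MEMO-12 §1: `μ_an(R q) = 0 → λ_an(R q) = n → Σ s_ℓ < n + s_{q₁}`, a fortiori) at such realisers,
no reading required. [cite: GreenbergLNM1716, §5 pp. 114–118, p. 137] [cite: GreenbergVatsal2000, §2 Prop. (2.4) (p. 22)] -/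
theorem X2.sum_sFactor_lt_analyticLambda_of_forall_sFactor_eq_one (hodd : p ≠ 2)
    (hPT : poitouTate_selmerStructure_duality ℚ)
    (h415 : Greenberg1999.prop415ii_noFiniteSubmodule_of_ordinary_or_multiplicative)
    (hWu : Wuthrich2014.thm16_charIdeal_dvd_multiplicative_of_reducible)
    (hpar : nonempty_modularParametrizationData) (hsq : Squarefree (W.conductorNorm ℤ))
    (hmult : W.HasMultiplicativeReductionAtPrime p) (htors : p ∣ W.torsionOrder)
    (hfac : (W.torsionOrder).factorization p = 1)
    (S : Finset (HeightOneSpectrum (𝓞 ℚ))) (hSp : ∀ v ∈ S, ((p : ℕ) : 𝓞 ℚ) ∉ v.asIdeal)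
    (hcv : ∀ v ∈ S,
      p ∣ (W.baseChange (v.adicCompletion ℚ)).localTamagawaNumber (v.adicCompletionIntegers ℚ))
    (hS : (splitPrimesOutside W p p).card ≤ S.card)
    (hs1 : ∀ ℓ ∈ splitPrimesOutside W p p, sFactor p ℓ = 1)
    {n : ℕ} (hμ0 : X2.AnalyticMuLE W p 0) (hlam : X2.AnalyticLambdaEq W p n) :
    ∑ ℓ ∈ splitPrimesOutside W p p, sFactor p ℓ < n := by
  rw [Finset.sum_congr rfl hs1, Finset.sum_const, smul_eq_mul, mul_one]
  exact X2.card_splitPrimesOutside_lt_analyticLambda W p hodd hPT h415 hWu hpar hsq hmult htors hfac S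
    hSp hcv hS hμ0 hlam

end Summit.BirchSwinnertonDyer.BirchSwinnertonDyer.Theorems.EisensteinPrimesX2OrderClauseLayerZero

end
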